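import Literature.MathematicalPhysics.QuantumFieldTheory.Balaban1983to89.B8Prop6CubeMemberFlatScalarGamma
import Literature.MathematicalPhysics.QuantumFieldTheory.Balaban1983to89.B8Prop6CubeMemberFlat3GammaG
import Literature.MathematicalPhysics.QuantumFieldTheory.Balaban1983to89.B8SockHFP59GammaTraceFree
import Literature.MathematicalPhysics.QuantumFieldTheory.Balaban1983to89.B8Prop5KLevelLettersG
import Literature.MathematicalPhysics.QuantumFieldTheory.Balaban1983to89.B8Eq191FlatLettersRDTau

/-!
# `Balaban1983to89.B8Prop6CubeMemberFlatScalarGammaG` — [Balaban1985RegularSpaces] PROPOSITION 6 (p. 99), EXISTENCE HALF, AT THE CONCRETE CUBE MEMBER FROM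
# THREE REAL INEQUALITY FAMILIES + THE (1.59) CLAUSE FOR `G(1)`, EDITION γ, **WITH A `G`-VALUED GAUGE TRANSFORMATION** (print p. 76 «G = SU(N)»): this seat's
# `B8Prop6CubeMemberFlatScalarGamma.prop6_cubeMember_flat_of_real_γ` re-run over ym3-torus's trace-free Proposition-5 bodies and the `G`-valued Theorem-4 frame

statement-level skeleton of published theorems with citation tags; proofs where landed; nothing here is a claim about the Yang–Mills mass gap

T. Bałaban, *Spaces of regular gauge field configurations on a lattice and gauge fixing conditions*, Commun. Math. Phys. **99** (1985) 75–102
`[Balaban1985RegularSpaces]` ("B8"): Prop. 6 p. 99, p. 98, Thm 4 p. 88, Prop. 5 (1.106)–(1.109) p. 94, Prop. 3 p. 87, (1.92) p. 91, (1.98) p. 92, (1.101) p. 93, (1.58)–(1.59)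
p. 86, (1.66) p. 87, (1.31) p. 82, p. 76 («we consider … G = SU(N)»); T. Bałaban, *Propagators for lattice gauge theories in a background field*, CMP **99** (1985)
389–434 `[Balaban1985BackgroundPropagators]` ("[4]"): Thms 3.1–3.3 pp. 397–399, (3.23)–(3.25) p. 394; T. Bałaban, *Propagators and renormalization transformations …
II*, CMP **96** (1984) 223–250 `[Balaban1984PropagatorsII]` (2.3) p. 224.  STATUS: published, refereed.

CITATION HEADER (lean-in-tree rule).  Cell `pub-ymgap` (HUMAN RULING D-0062, Track A), DAG node N05 = [B8], seat `pub-ymgap-dag-n05-e` g33 (Prop-6 γ-crown authoring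
lineage; g10 typed `B8Prop6CubeMemberFlatScalarGamma`), CROSS-CELL SERVICE for cell `ym3-torus` (LEAD-H ★ym-ust-19200-w5 g6, line H-P6J of crux stmt-QuantumFields-19200;
pub-ymgap bus XCELL-1∕2, INTENT-G1): file (F4) of the `G`-valued re-run of this seat's γ chain — THE ONE FILE WHERE THE GROUP ENTERS THE ANALYSIS: Proposition 5's
sockets are DISCHARGED here, so the delivered `v = e^{iλ}` must be `G`-valued, i.e. `λ` trace-free — served by ym3-torus's `B8SockHFPTraceFree.
sockHFP₀_body_of_join_RD_traceFree` (base) and `B8SockHFP59GammaTraceFree.sockHFP_body_of_join_59_γ_traceFree` (step, p678428), read through (F4a)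
`B8Prop5KLevelLettersG.hP5base_of_HFP_mem` ∕ `hP5_of_HFP_mem`, with the [4]-letters' `τ`-compatibility from (F3) `B8Eq191FlatLettersRDTau.flatLettersRD_of_real_tau` and
the frame (F2) `B8Prop6CubeMemberFlat3GammaG.prop6_exists_cubeMember_at_γ₃_mem`.  WHAT IS REPRODUCED.  ★★ `prop6_cubeMember_flat_of_real_γ_mem` — the original
VERBATIM (statement and proof) except the J-SU parameters `(τ) (hτ) {G H} (hGrp2) (hGrp3) (hGA) (hGH) (hGu) (hexpG)`, `U₀` `G`-valued, conclusion `u ∈ G`, `v⁻¹u ∈ G`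
(`v = localGauge …`), and the five proof insertions named above (cut field ∕ gauge-fixed fields `G`-valued: `B8Ineq133.cutCfg_mem`, `B8Prop6OfThm4.localGauge_mem`,
`B8Prop5KLevelLettersG.mem_of_mgauge_eq`; datum exponents `τ`-free: `apply_eq_zero_of_cfgExp_mem_of_le_twelfth` at `η|A| ≤ c⋆ ≤ 1∕12`).  By-name twin; no new analysis.
Kind «kernel-checked proof», theorems only: no `def`, no `… : Prop` fact, no `instance`, no `notation`, no existing module modified.  `--supports stmt-QuantumFields-19200`
(ym3-torus's crux; count-neutral for both cells).

HONEST SCOPE ∕ A6.  Exactly as `B8Prop6CubeMemberFlatScalarGamma`: the three REAL families and the (1.59) socket `H59Dβ₁` are HYPOTHESES (discharged downstream in the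
chain by dag-n05-c's suppliers and the flat (1.59) line); the J-SU data are PARAMETERS (inhabited at `M_N(ℂ)`, `N ≤ 25`, by ym3-torus's `B8SpecialUnitaryTrace` ∕
`B8SpecialLinearTrace` ∕ `B7AvgClosedSpecialUnitarySharp`); nothing of [B8]∕[4] asserted; N05's Track-A status untouched; rung R3 is ym3-torus's and NOT Clay; pub-ymgap =
one finite 𝕋⁴ programme at fixed ε; nothing continuum ∕ ℝ⁴ ∕ OS ∕ mass-gap ∕ Clay.  No `sorry`, no `def`.
-/

noncomputable section

namespace Literature.MathematicalPhysics.QuantumFieldTheory.Balaban1983to89.B8Prop6CubeMemberFlatScalarGammaG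

open scoped Matrix
open B7Prop1Explicit B7Prop2Explicit B7Prop1Local B7Eq92Concrete B8Ineq130
open B7Prop2Explicit (C0 c2')
open B7Prop3Flat (c3)
open B7Prop10General (C6)
open B7Eq78Linearization (QprimeIter zdBlocking)
open B8Ineq132 (covDerivFwd InAk BondTouches)
open B8Ineq133 (cutFixed)
open B8Eq115GaugeFixing (localGauge)
open B8Eq119TwistedAxial (InAx Restr129 bgT)
open B8Eq184Proof (gaugeExp cfgExp)
open B8Lemma1NonAbelian (mulCfg)
open B8Eq140Level (SideTouches)
open B8Eq146AExpansion (iEta)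
open B7Prop4GeneralLevels (linCovIter)
open B8Eq155JBound (Jcur wsup)
open B8ScaledSupNorm (bondNorm msup)
open B8Thm2LogB (blockTop)
open B8Eq138LandauZd (IsLandau138W logCfg covLap QT)
open B8Eq1117Concrete (XSpace)
open B8Prop5ContractionKLevel (Bd2)
open B8LambdaSpaceKLevel (wt)
open B8Eq131Cubes (tcube tLo tHi ctr)
open B8Eq131CubesAdmissible (cubeFam)
open B8CubeMemberZd (cubeLamS cubeLamB hΩ_cubeFam hbox_cubeLamB hclass_cubeLamB)
open B8Ineq133CubeMemberGamma (thm4_hypotheses_one_cutFixed_γ)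
open B8Prop6CubeMemberFlat3GammaG (prop6_exists_cubeMember_at_γ₃_mem)
open B9SupplySockB9P3ZdGamma (cubeLamBP')
open B8CubeMemberLamBPrimeLaws (cubeLamBP'_hbox_pred cubeLamBP'_hclass)
open B8Thm4ExistsConcreteGamma (thm4_windows_γ)
open B8LeafKnitZd3CubBdryBeta (bdryLayer_cubeMember)
open B9SupplySockB9P3ZdBeta (CrossB)
open B8SockHFPWindows (hfpWindows_of_guard)
open B7ConclGaugeLin (two_le_C6')
open B8SockHFPTraceFree (sockHFP₀_body_of_join_RD_traceFree)
open B8SockHFP59GammaTraceFree (sockHFP_body_of_join_59_γ_traceFree)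
open B8SockHFPCubeMember (htw_cubeLamS h8lt_cubeLamS h8top_cubeLamS)
open B8Prop5KLevelLettersG (hP5base_of_HFP_mem hP5_of_HFP_mem mem_of_mgauge_eq apply_eq_zero_of_cfgExp_mem_of_le_twelfth)
open Literature.MathematicalPhysics.QuantumLattice (blockMap)
open B8Eq191FlatLettersDirichlet (exists_towerFinset)
open B8Eq191FlatLettersCubeMember (cubeLamS_finite cubeFam_zero_finite cubeFam_subset_zero tower_meets_cube towers_disjoint_cube)
open B8Eq191FlatLettersRDTau (flatLettersRD_of_real_tau)
open B8Ineq159FlatOfScalarBdryBeta (flat159_clause_of_scalar_bdryβ)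
open B8Eq138LandauZd (IsLandau138)
open B8Prop6OfThm4 (localGauge_mem)
open B8Ineq132 (pdevOn_lt_of_inAk)
open B8Eq131Cubes (tLo_le_tHi)
open B8Eq115GaugeFixing (gaugeAct_mem_of)
open B7Prop1Explicit (expUnit)
open MatrixLog (mlog)
open NormedSpace

export B7Prop1Explicit (Site)

variable {d : ℕ}

variable {𝔸 : Type} [CStarAlgebra 𝔸] [Nontrivial 𝔸]

/-! ## Proposition 6 at the cube member from three real inequality families and the (1.59) clause for `G(1)`, `G`-valued gauge transformation -/

open Classical in
/-- ★★ **PROPOSITION 6 (p. 99), EXISTENCE HALF, AT THE CONCRETE CUBE MEMBER FROM THREE REAL INEQUALITY FAMILIES AND THEOREM 4's (1.59) CLAUSE AT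
BACKGROUND `1`, EDITION γ, WITH A `G`-VALUED GAUGE TRANSFORMATION** (print p. 76 «we consider … G = SU(N)»).  `B8Prop6CubeMemberFlatScalarGamma.
prop6_cubeMember_flat_of_real_γ` VERBATIM (the three REAL families, the (1.59) socket `H59Dβ₁`, the windows, the threshold `min (min c₀ c_P) c₃`) except: the joint
J-SU data of ym3-torus's trace-free Proposition-5 bodies are parameters — a continuous tracial `τ`, groups `G ≤ H ≤ 𝔸ˣ` with `G` averaging-closed and unitary, (H2)
`τ(log h) = 0` for `h ∈ H` near `1`, (H3) `e^S ∈ H` for `τ`-free `S`, and the closure `hexpG` («`e^{iλ} ∈ G` for Hermitian `τ`-free `λ`», at `SU(N)`: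
`B8SpecialUnitaryTrace.gaugeExp_mem_specialUnitaryUnits`) —, the configuration `U₀` is `G`-VALUED, and the conclusion's `u` and `w = v⁻¹u` are `G`-VALUED.
PROOF = the original's with: (F2) `prop6_exists_cubeMember_at_γ₃_mem` as the frame; Proposition 5's base ∕ step bodies served by ym3-torus's
`B8SockHFPTraceFree.sockHFP₀_body_of_join_RD_traceFree` ∕ `B8SockHFP59GammaTraceFree.sockHFP_body_of_join_59_γ_traceFree` (conclusion `τ(λ) = 0` ⇒ `e^{iλ} ∈ G` by
`hexpG`) through the `G`-bridges (F4a) `hP5base_of_HFP_mem` ∕ `hP5_of_HFP_mem`; the [4]-letters' `τ`-compatibility from (F3) `flatLettersRD_of_real_tau` (real kernels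
⊗ id); the datum's exponent `τ`-free by `apply_eq_zero_of_cfgExp_mem_of_le_twelfth` — the cut field `U₀″` and every `U₁ = U₀″^{u₁⁻¹}` are `G`-valued
(`B8Ineq133.cutCfg_mem`, `localGauge_mem`, `mem_of_mgauge_eq`) and `η|A| ≤ c⋆ ≤ 1∕12`.
[cite: Balaban1985RegularSpaces, Prop. 6 p.99, Thm 4 p.88, Prop. 5 pp.93–94, (1.106)–(1.109) p.94, (1.92) p.91, (1.98) p.92, (1.101) p.93, (1.59) p.86, (1.66) p.87, (1.31) p.82, p.76; Balaban1985BackgroundPropagators, Thms 3.1–3.3 pp.397–399, (3.23)–(3.25) p.394] -/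
theorem prop6_cubeMember_flat_of_real_γ_mem (τ : 𝔸 →L[ℂ] ℂ) (hτ : ∀ x y : 𝔸, τ (x * y) = τ (y * x)) (hd2 : 2 ≤ d) {L : ℕ} (hL : 2 ≤ L)
    -- the groups of the joint J-SU: `G` (values of `U₀` AND of the gauge transformations; averaging-closed, unitary, closed under `e^{iλ}` for Hermitian
    -- `τ`-free `λ`) `≤ H` ((H2) `τ(log h) = 0` near `1`, (H3) `e^S ∈ H` for `τ`-free `S`); at `M_N(ℂ)`: `G = SU(N)`, `H = SL(N, ℂ)`, `τ = tr`
    {G H : Subgroup 𝔸ˣ} (hGrp2 : ∀ g ∈ H, ‖(g : 𝔸) - 1‖ ≤ 1 / 8 → τ (mlog (g : 𝔸)) = 0) (hGrp3 : ∀ S : 𝔸, τ S = 0 → expUnit S ∈ H)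
    (hGA : AvgClosed d L G) (hGH : G ≤ H) (hGu : G ≤ unitaryUnits 𝔸)
    (hexpG : ∀ lam : Site d → 𝔸, (∀ x, IsSelfAdjoint (lam x)) → (∀ x, τ (lam x) = 0) → ∀ x, gaugeExp lam x ∈ G)
    {B₀ B₀' B₀'H B₂' BG BR : ℝ} (hB₀ : 0 < B₀) (hB₀' : 0 < B₀')
    (hB : 2 ≤ 5 * (d : ℝ) * L * B₀) (hB₀'H : 0 < B₀'H) (hB₂' : 0 ≤ B₂') (hBG : 0 ≤ BG) (hBR : 0 ≤ BR)
    (hfree : 3 * (2 * (d : ℝ) * (L : ℝ) ^ 2) * BG * BR ≤ B₀') {Bbd : ℝ} (hBbd : 0 ≤ Bbd) (hBd : 4 * Bbd ≤ ((d : ℝ) * L - 1) * B₀) :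
    ∃ c₁ : ℝ, 0 < c₁ ∧ ∀ (η : ℝ), 0 < η → ∀ (k : ℕ), 1 ≤ k → ∀ (a : Site d) (M ρ : ℕ), L ≤ ρ → ρ ≤ M → 11 * (d : ℝ) < M →
      ∀ (U₀ : Site d → Fin d → 𝔸ˣ), (∀ x κ, U₀ x κ ∈ G) → ∀ (α₀ : ℝ), 0 < α₀ →
      C0 d * (α₀ * (L : ℝ) ^ 2) ≤ 1 / 3 → 2 * (α₀ * (L : ℝ) ^ 2) ≤ c2' d L →
      ∀ (Ω : ℕ → Set (Site d)), InAk L k η α₀ Ω U₀ → tcube L a M ρ k ⊆ Ω (k - 1) →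
      11 * (d : ℝ) ^ 2 * (L : ℝ) ^ 2 * α₀ + ((M : ℝ) + 4 * ρ) * d * (L : ℝ) ^ 2 * α₀ ≤ 1 / 6 →
      (L : ℝ) ^ 3 * α₀ + 6 * d * (L : ℝ) ^ 2 * M * α₀ ≤ c₁ →
      -- the weights of `Q′ᵀaQ′` (free, nonnegative) and THE THREE REAL INEQUALITY FAMILIES at every truncation `n ≤ k` on the explicit matrices
      ∀ (w : ℕ → ℝ), (∀ j, 0 ≤ w j) →
      (∀ n, 1 ≤ n → n ≤ k → ∀ (S : Finset (Site d)), (∀ x, x ∈ S ↔ x ∈ cubeFam false L a M ρ k 0) →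
        ∀ (B : Finset (ℕ × Site d)), (∀ p, p ∈ B ↔ p.1 ≤ n ∧ p.2 ∈ cubeLamS L a M ρ k n p.1) →
        ∀ (K : Site d → Site d → ℝ), (∀ x z, K x z =
          ((η ^ 2)⁻¹ * ∑ μ : Fin d, ((2 : ℝ) * (if z = x then (1 : ℝ) else 0) - (if z = x + e μ then (1 : ℝ) else 0)
            - (if z = x - e μ then (1 : ℝ) else 0))) +
          (∑ j ∈ Finset.range (n + 1), (if blockMap (L ^ j) x ∈ cubeLamS L a M ρ k n j ∧ blockMap (L ^ j) z = blockMap (L ^ j) x then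
            w j * ((((L : ℝ) ^ d)⁻¹) ^ j) ^ 2 else 0))) →
        ∀ (T : Matrix ↥S ↥S ℝ), T = Matrix.of (fun x z : ↥S => K x.1 z.1) →
        ∀ (Q : Matrix ↥B ↥S ℝ), Q = Matrix.of (fun (p : ↥B) (z : ↥S) =>
          if blockMap (L ^ p.1.1) z.1 = p.1.2 then (((L : ℝ) ^ d)⁻¹) ^ p.1.1 else 0) →
        -- (1.101) for `T⁻¹`, real lattice functions
        (∀ (ρ' : ↥S → ℝ) (r : ℝ), 0 ≤ r →
          (∀ j, j ≤ n → ∀ z : ↥S, z.1 ∈ cubeFam false L a M ρ k j → wt L η j ^ 2 * |ρ' z| ≤ r) →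
          ∀ φ : Site d → ℝ, (∀ x, x ∉ cubeFam false L a M ρ k 0 → φ x = 0) → (∀ v : ↥S, φ v.1 = ∑ z : ↥S, T⁻¹ v z * ρ' z) →
          (∀ x, |φ x| ≤ BG * r) ∧
          ∀ j, j ≤ n → ∀ p ∈ {b : Site d × Fin d | SideTouches (cubeFam false L a M ρ k j) b.1 b.2},
            wt L η j * |η⁻¹ * (φ (p.1 + e p.2) - φ p.1)| ≤ BG * r) ∧
        -- (1.92) and the p. 93 `Δ`-entry for `T⁻¹(T⁻¹Qᵀ)(QT⁻¹T⁻¹Qᵀ)⁻¹`, real `X`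
        (∀ (X : ↥B → ℝ) (s : ℝ), 0 ≤ s → (∀ p', |X p'| ≤ s) →
          ∀ φ : Site d → ℝ, (∀ x, x ∉ cubeFam false L a M ρ k 0 → φ x = 0) →
          (∀ v : ↥S, φ v.1 = ∑ p' : ↥B, (T⁻¹ * (T⁻¹ * Qᵀ) * (Q * T⁻¹ * T⁻¹ * Qᵀ)⁻¹) v p' * X p') →
          (∀ x, |φ x| ≤ B₀'H * s) ∧
          (∀ j, j ≤ n → ∀ p ∈ {b : Site d × Fin d | SideTouches (cubeFam false L a M ρ k j) b.1 b.2},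
            wt L η j * |η⁻¹ * (φ (p.1 + e p.2) - φ p.1)| ≤ B₀'H * s) ∧
          (∀ j, j ≤ n → ∀ x ∈ cubeFam false L a M ρ k j,
            wt L η j ^ 2 * |∑ μ : Fin d, (η ^ 2)⁻¹ * (2 * φ x - φ (x + e μ) - φ (x - e μ))| ≤ B₂' * s)) ∧
        -- (1.98) for `1 − T⁻¹Qᵀ(QT⁻¹T⁻¹Qᵀ)⁻¹QT⁻¹`, real lattice functions
        (∀ (ρ' : ↥S → ℝ) (r : ℝ), 0 ≤ r →
          (∀ j, j ≤ n → ∀ z : ↥S, z.1 ∈ cubeFam false L a M ρ k j → wt L η j ^ 2 * |ρ' z| ≤ r) →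
          ∀ j, j ≤ n → ∀ v : ↥S, v.1 ∈ cubeFam false L a M ρ k j →
            wt L η j ^ 2 * |ρ' v - ∑ z : ↥S, (T⁻¹ * (Qᵀ * ((Q * T⁻¹ * T⁻¹ * Qᵀ)⁻¹ * (Q * T⁻¹)))) v z * ρ' z| ≤ BR * r)) →
      -- (1.59) for `G(1)` IN THE REPAIRED CURRENCY — Theorem 4's two-member clause at background `1` with the support clause and the
      -- exterior-collar allowance (VERBATIM `B8Prop6CubeMemberFlat3Bdry`'s `H59D₁`)
      ((∀ m, 1 ≤ m → m ≤ k → ∀ (u : Site d → 𝔸ˣ) (W : Site d → Fin d → 𝔸ˣ) (A' : Site d → Fin d → 𝔸),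
        (∀ x, u x ∈ unitaryUnits 𝔸) → (∀ x, x ∉ (cubeFam false L a M ρ k) 0 → u x = 1) →
          mgauge (1 : Site d → Fin d → 𝔸ˣ) u W = (cutFixed L (tLo a ρ) (tHi a M ρ) U₀ k (ctr a M)) →
          Restr129 L m ((cubeLamS L a M ρ k) m) (1 : Site d → Fin d → 𝔸ˣ) u →
          IsLandau138W L m η ((cubeFam false L a M ρ k) 0) ((cubeLamS L a M ρ k) m) (1 : Site d → Fin d → 𝔸ˣ) W →
        (∀ y τ, IsSelfAdjoint (A' y τ)) →
        (∀ j, j ≤ m → ∀ y τ, SideTouches ((cubeFam false L a M ρ k) j) y τ →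
        W y τ = cfgExp η A' y τ ∧
          ‖A' y τ‖ ≤ (2 * (L * (5 * (d : ℝ) * L * B₀ * (((L : ℝ) ^ 3 * α₀) + (6 * d * (L : ℝ) ^ 2 * M * α₀)))) + 8 * (8 * B₀' * (5 * (d : ℝ) * L * B₀) * (((L : ℝ) ^ 3 * α₀) + (6 * d * (L : ℝ) ^ 2 * M * α₀)))) * ((L : ℝ) ^ j * η)⁻¹) →
        (∀ y τ, (∀ j, j ≤ m → ¬ SideTouches ((cubeFam false L a M ρ k) j) y τ) → A' y τ = 0) →
        msup L m η (-(1 : ℝ)) (fun j (b : Site d × Fin d) => SideTouches ((cubeFam false L a M ρ k) j) b.1 b.2) (fun b => A' b.1 b.2)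
        ≤ B₀ * (bondNorm L m η (-(3 : ℝ)) (cubeFam false L a M ρ k) (fun x μ => Jcur η (1 : Site d → Fin d → 𝔸ˣ) A' μ x)
        + wsup 1 (fun p : {p : ℕ × (Site d × Fin d) // p.1 ≤ m ∧ (p.2 ∈ (cubeLamBP' L a M ρ k) m p.1 ∨ (p.1 = 0 ∧ CrossB ((cubeFam false L a M ρ k) 0) p.2))} =>
        linCovIter L (1 : Site d → Fin d → 𝔸ˣ) (iEta η A') p.1.1 p.1.2.1 p.1.2.2))
        + Bbd * msup L m η (-(1 : ℝ)) (fun j (b : Site d × Fin d) => j = 0 ∧ SideTouches ((cubeFam false L a M ρ k) 0) b.1 b.2 ∧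
            ¬ BondTouches ((cubeFam false L a M ρ k) 0) b.1 b.2) (fun b => A' b.1 b.2) ∧
        msup L m η (-(2 : ℝ)) (fun j (t : Fin d × Fin d × Site d) => SideTouches ((cubeFam false L a M ρ k) j) t.2.2 t.2.1)
        (fun t => covDerivFwd η (1 : Site d → Fin d → 𝔸ˣ) t.1 (fun z => A' z t.2.1) t.2.2)
        ≤ B₀ * (bondNorm L m η (-(3 : ℝ)) (cubeFam false L a M ρ k) (fun x μ => Jcur η (1 : Site d → Fin d → 𝔸ˣ) A' μ x)
        + wsup 1 (fun p : {p : ℕ × (Site d × Fin d) // p.1 ≤ m ∧ (p.2 ∈ (cubeLamBP' L a M ρ k) m p.1 ∨ (p.1 = 0 ∧ CrossB ((cubeFam false L a M ρ k) 0) p.2))} =>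
        linCovIter L (1 : Site d → Fin d → 𝔸ˣ) (iEta η A') p.1.1 p.1.2.1 p.1.2.2))
        + Bbd * msup L m η (-(1 : ℝ)) (fun j (b : Site d × Fin d) => j = 0 ∧ SideTouches ((cubeFam false L a M ρ k) 0) b.1 b.2 ∧
            ¬ BondTouches ((cubeFam false L a M ρ k) 0) b.1 b.2) (fun b => A' b.1 b.2))) →
      ∃ u : Site d → 𝔸ˣ, (∀ x, u x ∈ G) ∧ (∀ x, x ∉ cubeFam false L a M ρ k 0 → u x = 1) ∧
        Restr129 L k (cubeLamS L a M ρ k k) (1 : Site d → Fin d → 𝔸ˣ) u ∧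
        IsLandau138W L k η (cubeFam false L a M ρ k 0) (cubeLamS L a M ρ k k) (1 : Site d → Fin d → 𝔸ˣ)
          (gaugeAct u⁻¹ (cutFixed L (tLo a ρ) (tHi a M ρ) U₀ k (ctr a M))) ∧
        (∀ j, j ≤ k → ∀ b ∈ {b : Site d × Fin d | SideTouches (cubeFam false L a M ρ k j) b.1 b.2},
          gaugeAct u⁻¹ (cutFixed L (tLo a ρ) (tHi a M ρ) U₀ k (ctr a M)) b.1 b.2 =
              cfgExp η (logCfg η (gaugeAct u⁻¹ (cutFixed L (tLo a ρ) (tHi a M ρ) U₀ k (ctr a M)))) b.1 b.2 ∧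
            IsSelfAdjoint (logCfg η (gaugeAct u⁻¹ (cutFixed L (tLo a ρ) (tHi a M ρ) U₀ k (ctr a M))) b.1 b.2) ∧
            ‖logCfg η (gaugeAct u⁻¹ (cutFixed L (tLo a ρ) (tHi a M ρ) U₀ k (ctr a M))) b.1 b.2‖ ≤
              (5 * (d : ℝ) * L * B₀ * ((L : ℝ) ^ 3 * α₀ + 6 * d * (L : ℝ) ^ 2 * M * α₀)) * ((L : ℝ) ^ j * η)⁻¹) ∧
        (∀ x, ((localGauge L (tLo a ρ) (tHi a M ρ) U₀ k (ctr a M))⁻¹ * u) x ∈ G) ∧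
        AgreeOn (tlo L (tLo a ρ) k) (thi L (tHi a M ρ) k)
          (gaugeAct ((localGauge L (tLo a ρ) (tHi a M ρ) U₀ k (ctr a M))⁻¹ * u)⁻¹ U₀)
          (gaugeAct u⁻¹ (cutFixed L (tLo a ρ) (tHi a M ρ) U₀ k (ctr a M))) := by
  have hL1 : 1 ≤ L := le_trans (by norm_num) hL
  have hd1 : 1 ≤ d := le_trans (by norm_num) hd2
  have hd0 : 0 < d := hd1
  have hLr : (1 : ℝ) ≤ L := by exact_mod_cast hL1
  have hdr : (1 : ℝ) ≤ d := by exact_mod_cast hd1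
  have hC6 : (2 : ℝ) ≤ C6 d := two_le_C6'
  obtain ⟨c₀, hc₀, P6⟩ := prop6_exists_cubeMember_at_γ₃_mem (𝔸 := 𝔸) hd2 hL hGA hGu hB₀ hB₀' hB hBbd hBd
  obtain ⟨cP, hcP, WIN⟩ := hfpWindows_of_guard hd1 hL1 hB₀ hB₀' hB hB₀'H hB₂' hBG hBR one_pos hfree
  obtain ⟨c₃, hc₃γ0, WINγ⟩ := thm4_windows_γ hd1 hL1 hB₀ hB₀' hB
  refine ⟨min (min c₀ cP) c₃, lt_min (lt_min hc₀ hcP) hc₃γ0, ?_⟩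
  intro η hη k hk a M ρ hρL hρM hM U₀ hU₀G α₀ hα hα3 hα2 Ω hA hT hsmall hc w hw REAL H59
  have hU₀ : ∀ x κ, U₀ x κ ∈ unitaryUnits 𝔸 := fun x κ => hGu (hU₀G x κ)
  have hc0 : (L : ℝ) ^ 3 * α₀ + 6 * d * (L : ℝ) ^ 2 * M * α₀ ≤ c₀ := hc.trans ((min_le_left _ _).trans (min_le_left _ _))
  have hcP' : (L : ℝ) ^ 3 * α₀ + 6 * d * (L : ℝ) ^ 2 * M * α₀ ≤ cP := hc.trans ((min_le_left _ _).trans (min_le_right _ _))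
  have hc3' : (L : ℝ) ^ 3 * α₀ + 6 * d * (L : ℝ) ^ 2 * M * α₀ ≤ c₃ := hc.trans (min_le_right _ _)
  have hρ : 1 ≤ ρ := hL1.trans hρL
  have hM1 : 1 ≤ M := hρ.trans hρM
  have hLpos : (0 : ℝ) < L := by positivity
  have hMpos : (0 : ℝ) < M := by exact_mod_cast hM1
  have hdpos : (0 : ℝ) < d := by exact_mod_cast hd0
  have hα₀' : 0 < (L : ℝ) ^ 3 * α₀ := by positivity
  have hα₁' : 0 < 6 * (d : ℝ) * (L : ℝ) ^ 2 * M * α₀ := by positivity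
  -- the pair `(1, U₀″)` at the member
  obtain ⟨hmem, h33, h34, hAx, h135, h66⟩ :=
    thm4_hypotheses_one_cutFixed_γ L hL hd1 k U₀ hU₀ hα hα3 hα2 a hρ hρM hM hη hA hT hsmall
  have hone : ∀ x κ, (1 : Site d → Fin d → 𝔸ˣ) x κ ∈ unitaryUnits 𝔸 := fun _ _ => (unitaryUnits 𝔸).one_mem
  have honeG : ∀ x κ, (1 : Site d → Fin d → 𝔸ˣ) x κ ∈ G := fun _ _ => G.one_mem
  -- the cut gauge-fixed field `U₀″` is `G`-valued (p. 98's local axial gauge is `G`-valued for averaging-closed `G`)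
  have hΩ' : ∃ l, l ≤ k ∧ k ≤ l + 1 ∧ ∀ x, InBox (tlo L (tLo a ρ) k) (thi L (tHi a M ρ) k) x → x ∈ Ω l :=
    ⟨k - 1, Nat.sub_le _ _, by omega, fun x hx => hT hx⟩
  have hvG : ∀ x, localGauge L (tLo a ρ) (tHi a M ρ) U₀ k (ctr a M) x ∈ G :=
    localGauge_mem L hL hGA k U₀ hU₀G hα hα3 hα2 (tLo_le_tHi hM1) (pdevOn_lt_of_inAk hL1 hα hA hΩ') (ctr a M)
  have hmemG : ∀ x κ, cutFixed L (tLo a ρ) (tHi a M ρ) U₀ k (ctr a M) x κ ∈ G := B8Ineq133.cutCfg_mem (gaugeAct_mem_of hU₀G hvG)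
  -- the windows at `(α₀, α₁) := (L³α₀, 6dL²Mα₀)`
  obtain ⟨hside, -, -, hsmall₁, -, -, hα3', hα4', hsmallW, hc₃, hsc, hα₃', hs₁, hs₂, hs₃, hs₄, hs₅, hs₆, hs₇, hsm, hprod8, hcA',
    ha₁', hb₁', hθ, h103, h106⟩ := WIN _ _ hα₀' hα₁' hcP' _ _ _ _ _ _ _ _ rfl rfl rfl rfl rfl rfl rfl rfl
  -- EDITION γ: [3] Prop. 4's windows one level lower and the (1.61) window with `C₂ := 16·131072(d+1)²·L²`, read at `α₂ := c⋆ ≤ 2(L c⋆) + 8α₄`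
  obtain ⟨g5, g6, g7, g9, g10, g13, g14⟩ := WINγ _ _ hα₀' hα₁' hc3' _ _ rfl rfl
  -- smallness read by the plain-currency bridges: `α₄ ≤ 1/84`, `c⋆ ≤ 1/12`, `a ≤ 1/4`, `2a ≤ c⋆`
  have hsum0 : 0 ≤ (L : ℝ) ^ 3 * α₀ + 6 * d * (L : ℝ) ^ 2 * M * α₀ := by positivity
  have hcs0 : 0 ≤ 5 * (d : ℝ) * L * B₀ * ((L : ℝ) ^ 3 * α₀ + 6 * d * (L : ℝ) ^ 2 * M * α₀) := by positivity
  have hα₄0 : 0 ≤ 8 * B₀' * (5 * (d : ℝ) * L * B₀) * ((L : ℝ) ^ 3 * α₀ + 6 * d * (L : ℝ) ^ 2 * M * α₀) := by positivity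
  have hs84 : 8 * B₀' * (5 * (d : ℝ) * L * B₀) * ((L : ℝ) ^ 3 * α₀ + 6 * d * (L : ℝ) ^ 2 * M * α₀) ≤ 1 / 84 := by
    have h := mul_le_mul_of_nonneg_right hC6 (mul_nonneg (by norm_num : (0 : ℝ) ≤ 2) hα₄0)
    nlinarith only [hs₁, h, hα₄0]
  have hcs12 : 5 * (d : ℝ) * L * B₀ * ((L : ℝ) ^ 3 * α₀ + 6 * d * (L : ℝ) ^ 2 * M * α₀) ≤ 1 / 12 := by
    have h1 : 5 * (d : ℝ) * L * B₀ * ((L : ℝ) ^ 3 * α₀ + 6 * d * (L : ℝ) ^ 2 * M * α₀) ≤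
        L * (5 * (d : ℝ) * L * B₀ * ((L : ℝ) ^ 3 * α₀ + 6 * d * (L : ℝ) ^ 2 * M * α₀)) := le_mul_of_one_le_left hcs0 hLr
    have h2 : L * (5 * (d : ℝ) * L * B₀ * ((L : ℝ) ^ 3 * α₀ + 6 * d * (L : ℝ) ^ 2 * M * α₀)) ≤
        d * (L * (5 * (d : ℝ) * L * B₀ * ((L : ℝ) ^ 3 * α₀ + 6 * d * (L : ℝ) ^ 2 * M * α₀))) :=
      le_mul_of_one_le_left (mul_nonneg hLpos.le hcs0) hdr
    linarith only [h1, h2, hsc]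
  have ha : 6 * (d : ℝ) * (L : ℝ) ^ 2 * M * α₀ ≤ 1 / 4 := by
    have h1 : 6 * (d : ℝ) * (L : ℝ) ^ 2 * M * α₀ ≤ (d : ℝ) * L * (6 * (d : ℝ) * (L : ℝ) ^ 2 * M * α₀) := by
      have hdL : (1 : ℝ) ≤ (d : ℝ) * L := one_le_mul_of_one_le_of_one_le hdr hLr
      exact le_mul_of_one_le_left hα₁'.le hdL
    linarith only [h1, hsmall₁]
  have ha2 : 2 * (6 * (d : ℝ) * (L : ℝ) ^ 2 * M * α₀) ≤ 5 * (d : ℝ) * L * B₀ * ((L : ℝ) ^ 3 * α₀ + 6 * d * (L : ℝ) ^ 2 * M * α₀) := by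
    have h1 : 2 * (6 * (d : ℝ) * (L : ℝ) ^ 2 * M * α₀) ≤ 2 * ((L : ℝ) ^ 3 * α₀ + 6 * d * (L : ℝ) ^ 2 * M * α₀) := by linarith only [hα₀']
    exact h1.trans (mul_le_mul_of_nonneg_right hB hsum0)
  -- the γ windows at `α₂ := c⋆` (monotone in `c⋆ ≤ 2(L c⋆) + 8α₄`)
  have hcsw : 5 * (d : ℝ) * L * B₀ * ((L : ℝ) ^ 3 * α₀ + 6 * d * (L : ℝ) ^ 2 * M * α₀) ≤
      2 * (L * (5 * (d : ℝ) * L * B₀ * ((L : ℝ) ^ 3 * α₀ + 6 * d * (L : ℝ) ^ 2 * M * α₀)))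
        + 8 * (8 * B₀' * (5 * (d : ℝ) * L * B₀) * ((L : ℝ) ^ 3 * α₀ + 6 * d * (L : ℝ) ^ 2 * M * α₀)) := by
    have h1 : 5 * (d : ℝ) * L * B₀ * ((L : ℝ) ^ 3 * α₀ + 6 * d * (L : ℝ) ^ 2 * M * α₀) ≤
        L * (5 * (d : ℝ) * L * B₀ * ((L : ℝ) ^ 3 * α₀ + 6 * d * (L : ℝ) ^ 2 * M * α₀)) := le_mul_of_one_le_left hcs0 hLr
    linarith only [h1, hcs0, hα₄0]
  have hLcsw := mul_le_mul_of_nonneg_left hcsw hLpos.le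
  have h16γ : 16 * ((L : ℝ) * (5 * (d : ℝ) * L * B₀ * ((L : ℝ) ^ 3 * α₀ + 6 * d * (L : ℝ) ^ 2 * M * α₀))) ≤ 1 := by
    linarith only [g7, hLcsw]
  have hsmallγ : Real.exp (4 * (800 * ((d : ℝ) + 1) ^ 2 * ((d : ℝ) + 4)) * ((L : ℝ) ^ 2 * ((L : ℝ) ^ 3 * α₀)))
      * (1 + 8 * (131072 * ((d : ℝ) + 1) ^ 2) * ((L : ℝ) * (5 * (d : ℝ) * L * B₀ * ((L : ℝ) ^ 3 * α₀ + 6 * d * (L : ℝ) ^ 2 * M * α₀)))) ≤ 2 := by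
    refine le_trans (mul_le_mul_of_nonneg_left ?_ (Real.exp_pos _).le) g9
    have h := mul_le_mul_of_nonneg_left hLcsw (show (0 : ℝ) ≤ 8 * (131072 * ((d : ℝ) + 1) ^ 2) by positivity)
    linarith only [h]
  have hc₃γ : 2 * ((L : ℝ) * (5 * (d : ℝ) * L * B₀ * ((L : ℝ) ^ 3 * α₀ + 6 * d * (L : ℝ) ^ 2 * M * α₀))) ≤ c3 d L := by
    linarith only [g10, hLcsw]
  have h61γ : 2 * (5 * (d : ℝ) * L * B₀ * ((L : ℝ) ^ 3 * α₀ + 6 * d * (L : ℝ) ^ 2 * M * α₀)) ^ 2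
      + 20 * d * ((L : ℝ) ^ 3 * α₀) * (5 * (d : ℝ) * L * B₀ * ((L : ℝ) ^ 3 * α₀ + 6 * d * (L : ℝ) ^ 2 * M * α₀))
      + 2 * (16 * (131072 * ((d : ℝ) + 1) ^ 2) * (L : ℝ) ^ 2) * (5 * (d : ℝ) * L * B₀ * ((L : ℝ) ^ 3 * α₀ + 6 * d * (L : ℝ) ^ 2 * M * α₀)) ^ 2
      ≤ (L : ℝ) ^ 3 * α₀ + 6 * d * (L : ℝ) ^ 2 * M * α₀ := by
    have hsq : (5 * (d : ℝ) * L * B₀ * ((L : ℝ) ^ 3 * α₀ + 6 * d * (L : ℝ) ^ 2 * M * α₀)) ^ 2 ≤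
        (2 * (L * (5 * (d : ℝ) * L * B₀ * ((L : ℝ) ^ 3 * α₀ + 6 * d * (L : ℝ) ^ 2 * M * α₀)))
          + 8 * (8 * B₀' * (5 * (d : ℝ) * L * B₀) * ((L : ℝ) ^ 3 * α₀ + 6 * d * (L : ℝ) ^ 2 * M * α₀))) ^ 2 :=
      pow_le_pow_left₀ hcs0 hcsw 2
    have hlin : 20 * d * ((L : ℝ) ^ 3 * α₀) * (5 * (d : ℝ) * L * B₀ * ((L : ℝ) ^ 3 * α₀ + 6 * d * (L : ℝ) ^ 2 * M * α₀)) ≤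
        20 * d * ((L : ℝ) ^ 3 * α₀) * (2 * (L * (5 * (d : ℝ) * L * B₀ * ((L : ℝ) ^ 3 * α₀ + 6 * d * (L : ℝ) ^ 2 * M * α₀)))
          + 8 * (8 * B₀' * (5 * (d : ℝ) * L * B₀) * ((L : ℝ) ^ 3 * α₀ + 6 * d * (L : ℝ) ^ 2 * M * α₀))) :=
      mul_le_mul_of_nonneg_left hcsw (by positivity)
    have hK0 : (0 : ℝ) ≤ 2 * (16 * (131072 * ((d : ℝ) + 1) ^ 2) * (L : ℝ) ^ 2) := by positivity
    have hsq' := mul_le_mul_of_nonneg_left hsq hK0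
    linarith only [g14, hsq, hlin, hsq']
  -- the exponent of a small `G`-valued datum is `τ`-free ((H2) at Theorem 4's window `η|A| ≤ c⋆ ≤ 1∕12`)
  have hAτ_of : ∀ {W : Site d → Fin d → 𝔸ˣ}, (∀ x κ, W x κ ∈ G) → ∀ {A : Site d → Fin d → 𝔸} {n : ℕ},
      (∀ j, j ≤ n → ∀ b ∈ {b : Site d × Fin d | SideTouches (cubeFam false L a M ρ k j) b.1 b.2},
        W b.1 b.2 = cfgExp η A b.1 b.2 ∧ IsSelfAdjoint (A b.1 b.2) ∧
          ‖A b.1 b.2‖ ≤ (5 * (d : ℝ) * L * B₀ * ((L : ℝ) ^ 3 * α₀ + 6 * d * (L : ℝ) ^ 2 * M * α₀)) * ((L : ℝ) ^ j * η)⁻¹) →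
      ∀ j, j ≤ n → ∀ b ∈ {b : Site d × Fin d | SideTouches (cubeFam false L a M ρ k j) b.1 b.2}, τ (A b.1 b.2) = 0 := by
    intro W hWG A n hdatW j hj b hb
    obtain ⟨hexp, -, hbd⟩ := hdatW j hj b hb
    refine apply_eq_zero_of_cfgExp_mem_of_le_twelfth τ hGH hGrp2 hη (hexp ▸ hWG b.1 b.2) ?_
    have hLj : (1 : ℝ) ≤ (L : ℝ) ^ j := one_le_pow₀ hLr
    have hinv : ((L : ℝ) ^ j * η)⁻¹ ≤ η⁻¹ := by
      rw [mul_inv]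
      calc ((L : ℝ) ^ j)⁻¹ * η⁻¹ ≤ 1 * η⁻¹ := by gcongr; exact inv_le_one_of_one_le₀ hLj
        _ = η⁻¹ := one_mul _
    calc η * ‖A b.1 b.2‖ ≤ η * ((5 * (d : ℝ) * L * B₀ * ((L : ℝ) ^ 3 * α₀ + 6 * d * (L : ℝ) ^ 2 * M * α₀)) * η⁻¹) :=
          mul_le_mul_of_nonneg_left (hbd.trans (mul_le_mul_of_nonneg_left hinv hcs0)) hη.le
      _ = 5 * (d : ℝ) * L * B₀ * ((L : ℝ) ^ 3 * α₀ + 6 * d * (L : ℝ) ^ 2 * M * α₀) := by field_simp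
      _ ≤ 1 / 12 := hcs12
  -- the member's geometry (edition γ: the split print class `cubeLamBP'`, box law «box ⊂ □_{j−1}», inner ∕ crossing ∕ mirrored trichotomy)
  have hΩc := hΩ_cubeFam (d := d) hL1 a M hρL k
  have hboxc := cubeLamBP'_hbox_pred (d := d) hL1 a M hρL k
  have hclassc := cubeLamBP'_hclass (d := d) hL1 a M hρL k
  have htw := htw_cubeLamS (d := d) hL1 a M ρ k
  have h8lt := h8lt_cubeLamS (d := d) L a M ρ k
  have h8top := h8top_cubeLamS (d := d) hL1 a M ρ k
  refine P6 η hη k hk a M ρ hρL hρM hM U₀ hU₀G α₀ hα hα3 hα2 Ω hA hT hsmall hc0 ?_ ?_ H59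
  · -- `P5base₁`: the base body at `U₀ = 1` + the plain-currency bridge
    refine hP5base_of_HFP_mem hd2 hη L hone hmem hs84 hcs12 ha ha2 (cubeFam false L a M ρ k) (cubeLamS L a M ρ k) h66
      fun A hdat => ?_
    classical
    obtain ⟨S, hS⟩ : ∃ S : Finset (Site d), ∀ x, x ∈ S ↔ x ∈ cubeFam false L a M ρ k 0 :=
      ⟨(cubeFam_zero_finite L a M ρ k).toFinset, fun x => Set.Finite.mem_toFinset _⟩
    obtain ⟨B, hB'⟩ := exists_towerFinset 1 (cubeLamS L a M ρ k 1) (fun j _ => cubeLamS_finite L a M ρ k 1 j)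
    obtain ⟨rG, rH, rR⟩ := REAL 1 le_rfl hk S hS B hB' _ (fun _ _ => rfl) _ rfl _ rfl
    obtain ⟨g, Δ, q, qs, Aw, c, H', g_rightΩ, c_range, hΔ, hqs, hq, hH0, hH1, hH2, hHsupp, hHequiv, hQH, hG, hGsupp, hGreal, hRbd,
      hRreal, hHτ, hGτ, hRτ⟩ := flatLettersRD_of_real_tau (𝔸 := 𝔸) τ hd0 hη hL1 1 (cubeFam false L a M ρ k)
        (fun j _ => cubeFam_subset_zero hL1 a M hρL k j) (cubeLamS L a M ρ k 1) w hw S hS (tower_meets_cube hL1 a M hρL hk)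
        (towers_disjoint_cube hL1 a M hρL hk) B hB' _ (fun _ _ => rfl) _ rfl _ rfl rG rH rR
    obtain ⟨lam, hlsa, hloff, hlτ, h108, hmul, h129'⟩ := sockHFP₀_body_of_join_RD_traceFree τ hτ hd2 hL hη hk hGrp2 hGrp3 hGA hGH hGu hΩc (htw 1 hk)
      hα₀' hα₁' hB₀ hB₀' rfl rfl honeG h33 h34 hAx hdat (hAτ_of hmemG hdat) g Δ q qs Aw c g_rightΩ
      c_range hΔ hqs hq H' hB₀'H hB₂' hBG hBR hH0 hH1 hH2 hHsupp hHequiv hQH hG hGsupp hGreal hRbd hRreal hHτ hGτ hRτ le_rfl le_rfl le_rfl hα3'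
      hα4' hsmallW hc₃ hsc hα₃' hs₁ hs₂ hs₃ hs₄ hs₅ hs₆ hs₇ hsm hprod8 rfl rfl rfl rfl hcA' ha₁' hb₁' hθ h103 h106
    exact ⟨lam, hlsa, hloff, hexpG lam hlsa hlτ, h108, hmul, h129'⟩
  · -- `P5step₁`: the step body at `U₀ = 1` with its (1.59) clause read off `H59₁` + the plain-currency bridge
    refine hP5_of_HFP_mem hd2 hη L k hone hs84 hcs12 (cubeFam false L a M ρ k) (cubeLamS L a M ρ k)
      fun m hm1 hmk u₁ U₁ A hu₁G hu₁S hW h129 hLan hdat => ?_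
    have hu₁ : ∀ x, u₁ x ∈ unitaryUnits 𝔸 := fun x => hGu (hu₁G x)
    have hU₁G : ∀ x κ, U₁ x κ ∈ G := mem_of_mgauge_eq honeG hmemG hu₁G hW
    classical
    obtain ⟨S, hS⟩ : ∃ S : Finset (Site d), ∀ x, x ∈ S ↔ x ∈ cubeFam false L a M ρ k 0 :=
      ⟨(cubeFam_zero_finite L a M ρ k).toFinset, fun x => Set.Finite.mem_toFinset _⟩
    obtain ⟨B, hB'⟩ := exists_towerFinset (m + 1) (cubeLamS L a M ρ k (m + 1)) (fun j _ => cubeLamS_finite L a M ρ k (m + 1) j)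
    obtain ⟨rG, rH, rR⟩ := REAL (m + 1) (by omega) hmk S hS B hB' _ (fun _ _ => rfl) _ rfl _ rfl
    obtain ⟨g, Δ, q, qs, Aw, c, H', g_rightΩ, c_range, hΔ, hqs, hq, hH0, hH1, hH2, hHsupp, hHequiv, hQH, hG, hGsupp, hGreal, hRbd,
      hRreal, hHτ, hGτ, hRτ⟩ := flatLettersRD_of_real_tau (𝔸 := 𝔸) τ hd0 hη hL1 (m + 1) (cubeFam false L a M ρ k)
        (fun j _ => cubeFam_subset_zero hL1 a M hρL k j) (cubeLamS L a M ρ k (m + 1)) w hw S hS (tower_meets_cube hL1 a M hρL hmk)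
        (towers_disjoint_cube hL1 a M hρL hmk) B hB' _ (fun _ _ => rfl) _ rfl _ rfl rG rH rR
    have hcDAlo : (d : ℝ) * (L : ℝ) ^ 2 * (5 * (d : ℝ) * L * B₀ * ((L : ℝ) ^ 3 * α₀ + 6 * d * (L : ℝ) ^ 2 * M * α₀)) ≤
        2 * (d : ℝ) * (L : ℝ) ^ 2 * (5 * (d : ℝ) * L * B₀ * ((L : ℝ) ^ 3 * α₀ + 6 * d * (L : ℝ) ^ 2 * M * α₀)) := by
      have h := mul_nonneg (by positivity : (0 : ℝ) ≤ (d : ℝ) * (L : ℝ) ^ 2) hcs0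
      linarith only [h]
    -- Theorem 4's two-member (1.59) clause WITH THE EXTERIOR-COLLAR ALLOWANCE for this datum, from `H59D₁` (allowance `c⋆ ≤ 2Lc⋆ + 8α₄`)
    have H59Dβm : ∀ A' : Site d → Fin d → 𝔸, (∀ y τ, IsSelfAdjoint (A' y τ)) →
        (∀ j, j ≤ m → ∀ (y : Site d) (τ : Fin d), SideTouches (cubeFam false L a M ρ k j) y τ →
          U₁ y τ = cfgExp η A' y τ ∧
            ‖A' y τ‖ ≤ (5 * (d : ℝ) * L * B₀ * ((L : ℝ) ^ 3 * α₀ + 6 * d * (L : ℝ) ^ 2 * M * α₀)) * ((L : ℝ) ^ j * η)⁻¹) →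
        (∀ (y : Site d) (τ : Fin d), (∀ j, j ≤ m → ¬ SideTouches (cubeFam false L a M ρ k j) y τ) → A' y τ = 0) →
        msup L m η (-(1 : ℝ)) (fun j (b : Site d × Fin d) => SideTouches (cubeFam false L a M ρ k j) b.1 b.2) (fun b => A' b.1 b.2)
            ≤ B₀ * (bondNorm L m η (-(3 : ℝ)) (cubeFam false L a M ρ k) (fun x μ => Jcur η (1 : Site d → Fin d → 𝔸ˣ) A' μ x)
              + wsup 1 (fun p : {p : ℕ × (Site d × Fin d) // p.1 ≤ m ∧ (p.2 ∈ cubeLamBP' L a M ρ k m p.1 ∨ (p.1 = 0 ∧ CrossB (cubeFam false L a M ρ k 0) p.2))} =>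
                  linCovIter L (1 : Site d → Fin d → 𝔸ˣ) (iEta η A') p.1.1 p.1.2.1 p.1.2.2))
              + Bbd * msup L m η (-(1 : ℝ)) (fun j (b : Site d × Fin d) => j = 0 ∧ SideTouches (cubeFam false L a M ρ k 0) b.1 b.2 ∧
                  ¬ BondTouches (cubeFam false L a M ρ k 0) b.1 b.2) (fun b => A' b.1 b.2) ∧
          msup L m η (-(2 : ℝ)) (fun j (t : Fin d × Fin d × Site d) => SideTouches (cubeFam false L a M ρ k j) t.2.2 t.2.1)
              (fun t => covDerivFwd η (1 : Site d → Fin d → 𝔸ˣ) t.1 (fun z => A' z t.2.1) t.2.2)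
            ≤ B₀ * (bondNorm L m η (-(3 : ℝ)) (cubeFam false L a M ρ k) (fun x μ => Jcur η (1 : Site d → Fin d → 𝔸ˣ) A' μ x)
              + wsup 1 (fun p : {p : ℕ × (Site d × Fin d) // p.1 ≤ m ∧ (p.2 ∈ cubeLamBP' L a M ρ k m p.1 ∨ (p.1 = 0 ∧ CrossB (cubeFam false L a M ρ k 0) p.2))} =>
                  linCovIter L (1 : Site d → Fin d → 𝔸ˣ) (iEta η A') p.1.1 p.1.2.1 p.1.2.2))
              + Bbd * msup L m η (-(1 : ℝ)) (fun j (b : Site d × Fin d) => j = 0 ∧ SideTouches (cubeFam false L a M ρ k 0) b.1 b.2 ∧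
                  ¬ BondTouches (cubeFam false L a M ρ k 0) b.1 b.2) (fun b => A' b.1 b.2) := by
      intro A' hsa hWA hA0
      refine H59 m hm1 hmk.le u₁ U₁ A' hu₁ hu₁S hW h129 hLan hsa (fun j hj y τ hs => ⟨(hWA j hj y τ hs).1, (hWA j hj y τ hs).2.trans ?_⟩)
        hA0
      have hw0 : 0 ≤ ((L : ℝ) ^ j * η)⁻¹ := by positivity
      refine mul_le_mul_of_nonneg_right ?_ hw0
      have h1 : 5 * (d : ℝ) * L * B₀ * ((L : ℝ) ^ 3 * α₀ + 6 * d * (L : ℝ) ^ 2 * M * α₀) ≤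
          L * (5 * (d : ℝ) * L * B₀ * ((L : ℝ) ^ 3 * α₀ + 6 * d * (L : ℝ) ^ 2 * M * α₀)) := le_mul_of_one_le_left hcs0 hLr
      linarith only [h1, hcs0, hα₄0]
    obtain ⟨lam, hlsa, hloff, hlτ, h108, hmul, h129'⟩ := sockHFP_body_of_join_59_γ_traceFree τ hτ hd2 hL hη hGrp2 hGrp3 hGA hGH hGu hΩc hboxc hclassc
      hm1 hmk (htw (m + 1) hmk) (h8lt m hmk) (h8top m hmk) hα₀' hα₁' hB₀
      hB₀' rfl rfl honeG hmem h33 h34 hAx h135 h66 (bdryLayer_cubeMember hL a M ρ k hρL hk) hBbd hBd hu₁ (fun x => hGH (hu₁G x)) hu₁S hW h129 hLan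
      hdat (hAτ_of hU₁G hdat) H59Dβm hside g13 h61γ hsmall₁ g5 g6 h16γ hsmallγ hc₃γ
      g Δ q qs Aw c g_rightΩ c_range hΔ hqs hq
      H' hB₀'H hB₂' hBG hBR hH0 hH1 hH2 hHsupp hHequiv hQH hG hGsupp hGreal hRbd hRreal hHτ hGτ hRτ le_rfl le_rfl hcDAlo hα3' hα4' hsmallW hc₃
      hsc hα₃' hs₁ hs₂ hs₃ hs₄ hs₅ hs₆ hs₇ hsm hprod8 rfl rfl rfl rfl hcA' ha₁' hb₁' hθ h103 h106
    exact ⟨lam, hlsa, hloff, hexpG lam hlsa hlτ, h108, hmul, h129'⟩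

#print axioms prop6_cubeMember_flat_of_real_γ_mem

end Literature.MathematicalPhysics.QuantumFieldTheory.Balaban1983to89.B8Prop6CubeMemberFlatScalarGammaG

end
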